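import Summits.QuantumFields.BalabanUV.Beta.GAN24.ThirdJetKernel
import Summits.QuantumFields.BalabanUV.Beta.GAN24.KSlotAssembly

/-!
# `BalabanUV.Beta.GAN24.TopBorderKSlot` — binder row G-an2-4 / (CONV-C), S-slot («E3Shape» ∧ «E3SupRate»), road S3: THE TOP BORDER
# ROWS Vt ∕ dVt REDUCE TO THE K-SLOT (part B of «ROW-dVt*», unit `b2b-balaban-gan24-formalise-leaf-05`, gen 19; part A = `GAN24/ThirdJetKernel`)

NOT IN PRINT; OUR PROOF.  HONEST FRAMING (cell contract, verbatim): «discharging `BetaPertH` makes Bałaban's UV stability UNCONDITIONAL — a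
real constructive-QFT result; it is NOT the continuum limit and NOT the Clay problem.»  HONEST DEPENDENCY (verbatim): «continuum YM on T⁴ ⇐
BetaPertH ∧ nine spine estimates (0/9 proved); BetaPertH ⇐ (D1) ∧ (D4) ∧ CAP+tail; G-an2-4 gates asym, D1 and NE2/3/4.»  [folklore] bookkeeping
over tree theorems BY NAME — an4's stencil-index swap `DecLiftAdjoint.vertexOf_borderPiece` (I1), an2's sandwich identity
`InterLevelTransport.dec_comp_avgLift_comp` (I2), `BalabanStepJetsSucc.mmRead_eq_dec` (I3), asym1's leg units `HessKerDressedUnits`, road P1's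
CLOSED K-slot `KSlotAssembly.convCK_holds` / `convCKWall_holds` — plus part A's generic calculus; NO new estimate on Bałaban's kernels beyond
what the K-slot already proved, NO cited fact, NO `def` at all, NO `def … : Prop`, NO wall binder instantiated; the reserved family
`GAN24.StencilSlotE3*` is untouched.  Statements of §2 copied from the row owner's staged ENDs (`StencilSlotE3OfPieces` 2cc3c5eb8d83de1a hypothesis
`hVt`; `StencilSlotE3RateOfPieces` 33c3b428985b41f4 hypothesis `dVt`; typer stubs `Statements/S3_PieceShapes.lean` `ShapeVt` / `DiffVt`) VERBATIM,
θ∕δ NOT strengthened (the lemma carries its own `(constant, rate)` = the K-slot's; ref2 r35 condition (l)).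

## The finding (kernel-checked below)
For member `j+1` of an2's composite family (one-shot blocking `N = Lc^{j+1}`, level `M = Lc^j`) the TOP border piece
`(cVH·M^{d+2}) • borderInc d Lc M` of `BalabanCompositeJets.Sc_succ` has unit-rescaled third jet
  `N^{2(d+1)} · e3OfS N ((cVH·M^{d+2}) • borderInc d Lc M) κ′ u′ = cVH · Lc^{2(d+1)} · e3K K̃_j K̃_j K̃_j Lc (mfNeg ∘ vhS d Lc) κ′ u′`
(`unit_e3OfS_borderInc_top`), `K̃_j = CombesThomas.KStepUnit Lc j = D_j · KInvStep Lc j · D_j` THE K-SLOT's OBJECT and `mfNeg ∘ vhS d Lc` the FIXED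
one-step (V-H) table: ALL THREE LEGS are the unit step resolvent, the member index enters ONLY through `K̃_j`.  Mechanism: the vertex leg `ℋ_N`
is summed against a table LIFTED from level `M` and therefore enters only through its `M`-decimated column (I1); the two outer legs are read at
`N•x′ = M•(Lc•x′)` and the lift is adjoint to decimation (I2)/(I3); `dec M (KInv N) = KInvStep Lc j` by `rfl`; the units `(Lc^j, Lc^{j(d+1)})`
absorb EXACTLY the prefactor `N^{2(d+1)}·M^{2(d+2)}` (`e3K_unit`).  Hence (§2): row S3-Vt ⇐ `UnitDecayK` (`shapeVt_of_unitDecayK`), row R3-dVt ⇐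
`UnitDecayK ∧ CauchyDecayK` (`diffVt_of_unitDecayK_cauchyDecayK`) — NO (N1), NO «(N1-Cauchy)», NO VH1 mass, NO Riemann-sum lemma for THESE TWO
rows; at `d = 3`, `Lc ≥ 2` both hypotheses are road P1's theorem `KSlotAssembly.convCKWall_holds` (§3: `shapeVt_three`, `diffVt_three`).
WHY ONLY THE TOP ROWS: at depth `n − m ≥ 1` (rows V∕dV) the table is lifted from `Lc^{m+1} < N∕Lc`, and `dec (Lc^{m+1}) (KInv N)` is a PARTIAL
decimation the K-slot does not control; the Wilson and level-0 rows are fine-level tables — there (N1)/(N1-Cauchy) stay the located input.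
HONEST: two of the seventeen PART III rows as functions of the K-slot + their `d = 3` instances; «E3Shape»/«E3SupRate»/(hS, hSall) NOT discharged
(ten other analytic rows untouched); NOT BetaPertH, NOT continuum, NOT Clay.
-/

noncomputable section

open Finset
open scoped BigOperators
open Literature.MathematicalPhysics.QuantumFieldTheory
open Literature.MathematicalPhysics.QuantumFieldTheory.Balaban1983to89
open Literature.MathematicalPhysics.QuantumFieldTheory.Balaban1983to89.Beta
open B12Sec2to5 (l1 l1_nonneg)
open ExpKernelCalculus (MKer Decays BiLoc VertexFamily comp Zl Zl_nonneg)
open OneStepResolventKernel (Fib LocStencil KInv decays_KInv decays_mono biLoc_mono)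
open OneStepKernelFamily (dec KInvStep decays_KInvStep vertexOfK vertexFamily_vertexOfK')
open BalabanStepJetsSucc (mmRead mmRead_inl_inl mmRead_eq_dec)
open StepJetData (mfNeg locStencil_mfNeg locStencil_smul)
open AveragingHessianKernels (vhS locStencil_vhS ell)
open InterLevelTransport (avgLift dec_comp_avgLift_comp)
open BalabanCompositeJets (borderInc)
open DecLiftAdjoint (vertexOf_borderPiece avgLift_smul vertexOfK_smul)
open Summit.QuantumFields.BalabanUV.Beta.HessKerDressedUnits (legScale unitK unitS unitS_apply legScale_inl legScale_inr)
open Summit.QuantumFields.BalabanUV.Beta.GAN24.CombesThomas (SupBound UnitDecayK CauchyDecayK ConvCK ConvCKWall sfStep smStep sfStep_ne_zero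
  smStep_ne_zero KStepUnit convCKWall_of_convCK)
open Summit.QuantumFields.BalabanUV.Beta.GAN24.E3UnitSplit (e3OfS)
open Summit.QuantumFields.BalabanUV.Beta.GAN24.ThirdJetKernel (e3K e3K_inl_inl e3K_inr_left e3K_inr_right e3K_smul e3K_unit e3ShapeConst
  e3LipConst locStencil_e3K_family supBound_e3K_step)
open Summit.QuantumFields.BalabanUV.Beta.GAN24.KSlotAssembly (convCK_holds convCKWall_holds)

namespace Summit.QuantumFields.BalabanUV.Beta.GAN24.TopBorderKSlot

variable {d : ℕ} {Lc : ℕ} [NeZero Lc]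

/-! ## §1 The exact reduction: the top border piece through the one-shot resolvent IS the step functional through `KInvStep` -/

omit [NeZero Lc] in
/-- [folklore] One more blocking in the `mm`-read: reading at the `Lc^{j+1}`-coarse points is reading at the `Lc^j`-coarse points of the
`Lc`-dilated arguments (`(Lc^{j+1}) • x = (Lc^j) • (Lc • x)`). -/
theorem mmRead_pow_succ (j : ℕ) (F : MKer (d + 1) (Fib d)) (x z : Fin (d + 1) → ℤ) (a b : Fib d) :
    mmRead (Lc ^ (j + 1)) F x z a b = mmRead (Lc ^ j) F ((Lc : ℤ) • x) ((Lc : ℤ) • z) a b := by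
  have e : (((Lc ^ (j + 1) : ℕ) : ℤ)) = ((Lc ^ j : ℕ) : ℤ) * (Lc : ℤ) := by
    push_cast
    exact pow_succ _ _
  have hsm : ∀ y : Fin (d + 1) → ℤ, (((Lc ^ (j + 1) : ℕ) : ℤ)) • y = (((Lc ^ j : ℕ) : ℤ)) • ((Lc : ℤ) • y) := by
    intro y
    rw [smul_smul, e]
  rcases a with α | μ <;> rcases b with β | ν
  · rw [mmRead_inl_inl, mmRead_inl_inl, hsm x, hsm z]
  · simp only [BalabanStepJetsSucc.mmRead_inr_right]
  · simp only [BalabanStepJetsSucc.mmRead_inr_left]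
  · simp only [BalabanStepJetsSucc.mmRead_inr_left]

/-- [folklore] **THE TOP BORDER PIECE THROUGH THE ONE-SHOT RESOLVENT IS THE STEP FUNCTIONAL THROUGH THE DECIMATED RESOLVENT** (exact, entrywise):
for member `j+1` (`N = Lc^{j+1}`, `M = Lc^j`) and any weight `c`,
`e3OfS N ((c·M^{d+2}) • borderInc d Lc M) κ′ u′ = e3K (KInvStep Lc j) Lc ((c·M^{d+2}·M^{d+2}) • (mfNeg ∘ vhS d Lc)) κ′ u′`.
(I1) `DecLiftAdjoint.vertexOf_borderPiece`; (I2) `InterLevelTransport.dec_comp_avgLift_comp` (hypotheses: `decays_KInv`, the step vertex is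
bi-localised by `vertexFamily_vertexOfK'` ∘ `decays_KInvStep`); (I3) `mmRead_eq_dec`; `dec M (KInv N) = KInvStep Lc j` by `rfl`. -/
theorem e3OfS_borderInc_top (hLc : 1 ≤ Lc) (c : ℝ) (j : ℕ) (κ' : Fin (d + 1)) (u' : Fin (d + 1) → ℤ) :
    e3OfS (Lc ^ (j + 1)) (fun κ u => (c * ((Lc : ℝ) ^ j) ^ (d + 2)) • borderInc d Lc (Lc ^ j) κ u) κ' u' =
      e3K (KInvStep (d := d) Lc j) Lc
        (fun κ u => (c * ((Lc : ℝ) ^ j) ^ (d + 2) * ((Lc : ℝ) ^ j) ^ (d + 2)) • mfNeg (vhS d Lc κ u)) κ' u' := by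
  -- the step vertex of the weighted one-step table is bi-localised (for (I2)'s Fubini)
  have hG : LocStencil (fun κ u => (c * ((Lc : ℝ) ^ j) ^ (d + 2) * ((Lc : ℝ) ^ j) ^ (d + 2)) • mfNeg (vhS d Lc κ u))
      (|c * ((Lc : ℝ) ^ j) ^ (d + 2) * ((Lc : ℝ) ^ j) ^ (d + 2)| * (3 * (ell (d + 1) Lc : ℝ) ^ 2 * Real.exp (4 * ((d : ℝ) + 1) * Lc * 1))) 1 :=
    locStencil_smul _ (locStencil_mfNeg (locStencil_vhS (d := d) hLc zero_le_one))
  obtain ⟨Cv, δv, hδv, hV⟩ := vertexFamily_vertexOfK' (N := Lc) (decays_KInvStep (d := d) (Lc := Lc) j) hG one_pos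
  obtain ⟨δK, CK, hδK, _, hK⟩ := decays_KInv (N := Lc ^ (j + 1)) (d := d)
  have hdec : dec (Lc ^ j) (KInv (N := Lc ^ (j + 1)) (d := d)) = KInvStep (d := d) Lc j := rfl
  funext x z a b
  rcases a with α | μ
  · rcases b with β | ν
    · rw [e3K_inl_inl]
      show -(mmRead (Lc ^ (j + 1)) (comp (comp (KInv (N := Lc ^ (j + 1)) (d := d))
          (OneStepResolventKernel.vertexOf (N := Lc ^ (j + 1))
            (fun κ u => (c * ((Lc : ℝ) ^ j) ^ (d + 2)) • borderInc d Lc (Lc ^ j) κ u) κ' u')) (KInv (N := Lc ^ (j + 1)) (d := d)))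
          x z (Sum.inl α) (Sum.inl β)) = _
      rw [vertexOf_borderPiece hLc c j κ' u', ← avgLift_smul, ← vertexOfK_smul, mmRead_pow_succ, mmRead_eq_dec,
        dec_comp_avgLift_comp (Lc ^ j) hK hδK.le hK hδK.le (hV κ' u') hδv, hdec]
    · simp only [E3UnitSplit.e3OfS_inl_inr, e3K_inr_right]
  · simp only [E3UnitSplit.e3OfS_inr, e3K_inr_left]

omit [NeZero Lc] in
/-- [folklore] **THE ADOPTED UNITS RESTORE THE WEIGHT-ONE TABLE**: for the off-diagonal one-step (V-H) family (`vhS` has `rfl`-zero ff∕mm blocks)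
`unitS s_f s_m ((s_f·s_m)² • (mfNeg ∘ vhS d Lc)) = mfNeg ∘ vhS d Lc` (nonzero units). -/
theorem unitS_smul_sq_mfNeg_vhS {sf sm : ℝ} (hsf : sf ≠ 0) (hsm : sm ≠ 0) :
    unitS sf sm (fun κ u => ((sf * sm) ^ 2) • mfNeg (vhS d Lc κ u)) = fun κ u => mfNeg (vhS d Lc κ u) := by
  funext κ u x y a b
  rw [unitS_apply]
  rcases a with α | μ <;> rcases b with β | ν
  · simp only [Pi.smul_apply, smul_eq_mul, StepJetData.mfNeg_inl_inl, show vhS d Lc κ u x y (Sum.inl α) (Sum.inl β) = 0 from rfl,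
      mul_zero, zero_mul]
  · simp only [Pi.smul_apply, smul_eq_mul, legScale_inl, legScale_inr]
    field_simp
  · simp only [Pi.smul_apply, smul_eq_mul, legScale_inl, legScale_inr]
    field_simp
  · simp only [Pi.smul_apply, smul_eq_mul, StepJetData.mfNeg_inr_inr, show vhS d Lc κ u x y (Sum.inr μ) (Sum.inr ν) = 0 from rfl,
      mul_zero, zero_mul]

/-- [folklore] **THE STEP FUNCTIONAL THROUGH THE UNIT RESOLVENT vs THROUGH THE RAW ONE**:
`e3K K̃_j Lc (mfNeg ∘ vhS) = s_m(j)² · (s_f(j)·s_m(j))² · e3K (KInvStep Lc j) Lc (mfNeg ∘ vhS)` (`e3K_unit`, `unitS_smul_sq_mfNeg_vhS`, `e3K_smul`). -/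
theorem e3K_KStepUnit (j : ℕ) (κ' : Fin (d + 1)) (u' : Fin (d + 1) → ℤ) (x z : Fin (d + 1) → ℤ) (a b : Fib d) :
    e3K (KStepUnit (d := d) Lc j) Lc (fun κ u => mfNeg (vhS d Lc κ u)) κ' u' x z a b =
      smStep d Lc j ^ 2 * ((sfStep Lc j * smStep d Lc j) ^ 2 * e3K (KInvStep (d := d) Lc j) Lc (fun κ u => mfNeg (vhS d Lc κ u)) κ' u' x z a b) := by
  have hsf := sfStep_ne_zero (Lc := Lc) j
  have hsm := smStep_ne_zero (d := d) (Lc := Lc) j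
  have h1 := e3K_unit hsf hsm (KInvStep (d := d) Lc j) Lc
    (fun κ u => ((sfStep Lc j * smStep d Lc j) ^ 2) • mfNeg (vhS d Lc κ u)) κ' u'
  rw [unitS_smul_sq_mfNeg_vhS hsf hsm, e3K_smul] at h1
  show e3K (unitK (sfStep Lc j) (smStep d Lc j) (KInvStep (d := d) Lc j)) Lc (fun κ u => mfNeg (vhS d Lc κ u)) κ' u' x z a b = _
  rw [h1]
  simp only [Pi.smul_apply, smul_eq_mul]

/-- [folklore] **THE UNIT-RESCALED TOP BORDER PIECE OF EVERY MEMBER IS ONE FIXED TRILINEAR FUNCTIONAL OF THE UNIT STEP RESOLVENT** against the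
FIXED one-step (V-H) table: for member `j+1` (`N = Lc^{j+1}`, `M = Lc^j`),
`N^{2(d+1)} · e3OfS N ((cVH·M^{d+2}) • borderInc d Lc M) κ′ u′ x z a b = cVH · Lc^{2(d+1)} · e3K K̃_j Lc (mfNeg ∘ vhS d Lc) κ′ u′ x z a b`,
`K̃_j = KStepUnit Lc j`.  The prefactor `N^{2(d+1)}·cVH·M^{d+2}·M^{d+2}` against the leg units `s_m² (s_f s_m)² = M^{2(d+1)}·M^{2(d+2)}` leaves EXACTLY
`cVH·Lc^{2(d+1)}` — `n`-free. -/
theorem unit_e3OfS_borderInc_top (hLc : 1 ≤ Lc) (cVH : ℝ) (j : ℕ) (κ' : Fin (d + 1)) (u' : Fin (d + 1) → ℤ)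
    (x z : Fin (d + 1) → ℤ) (a b : Fib d) :
    ((Lc : ℝ) ^ (j + 1)) ^ (2 * (d + 1)) *
        e3OfS (Lc ^ (j + 1)) (fun κ u => (cVH * ((Lc : ℝ) ^ j) ^ (d + 2)) • borderInc d Lc (Lc ^ j) κ u) κ' u' x z a b =
      cVH * (Lc : ℝ) ^ (2 * (d + 1)) * e3K (KStepUnit (d := d) Lc j) Lc (fun κ u => mfNeg (vhS d Lc κ u)) κ' u' x z a b := by
  rw [e3OfS_borderInc_top hLc cVH j κ' u', e3K_smul, e3K_KStepUnit]
  simp only [Pi.smul_apply, smul_eq_mul, sfStep, smStep]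
  ring

/-! ## §2 The two top border rows as functions of the K-slot predicates (generic `d`; statements = the ENDs' hypotheses verbatim) -/

/-- **ROW S3-Vt AS A FUNCTION OF THE K-SLOT's UNIFORM DECAY** (the hypothesis `hVt` of `StencilSlotE3OfPieces.e3Shape_of_pieces`, statement copied
from staged 2cc3c5eb8d83de1a ∕ typer stub `S3.ShapeVt`, VERBATIM; NOT IN PRINT; [folklore] over the K-slot): `UnitDecayK d Lc (Lc^·) (Lc^{·(d+1)}) C δ`,
`0 < δ`, `1 ≤ Lc` ⟹ for EVERY member the unit-rescaled top border piece is a local stencil family with the `n`-FREE constant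
`CtV = |cVH|·Lc^{2(d+1)}·e3ShapeConst d C (3ℓ²e^{4(d+1)Lcδ}) δ` and rate `δ/8`.  Discharges NOTHING of «E3Shape» by itself (one hypothesis of seven);
NOT BetaPertH, NOT continuum, NOT Clay. -/
theorem shapeVt_of_unitDecayK (hLc : 1 ≤ Lc) {C δ : ℝ} (hδ : 0 < δ) (hK : UnitDecayK d Lc (sfStep Lc) (smStep d Lc) C δ) (cVH : ℝ) :
    ∀ n : ℕ, LocStencil (fun κ' u' x' z' a b => ((Lc : ℝ) ^ (n + 1 + 1)) ^ (2 * (d + 1)) *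
      e3OfS (Lc ^ (n + 1 + 1)) (fun κ u => (cVH * ((Lc : ℝ) ^ (n + 1)) ^ (d + 2)) • borderInc d Lc (Lc ^ (n + 1)) κ u) κ' u' x' z' a b)
      (|cVH| * (Lc : ℝ) ^ (2 * (d + 1)) * e3ShapeConst d C (3 * (ell (d + 1) Lc : ℝ) ^ 2 * Real.exp (4 * ((d : ℝ) + 1) * Lc * δ)) δ) (δ / 8) := by
  intro n κ' u' x z a b
  dsimp only
  have h := locStencil_e3K_family hK (locStencil_mfNeg (locStencil_vhS (d := d) hLc hδ.le)) hδ le_rfl hLc (n + 1) κ' u' x z a b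
  rw [unit_e3OfS_borderInc_top hLc cVH (n + 1) κ' u' x z a b, abs_mul, abs_mul, abs_of_nonneg (by positivity : (0 : ℝ) ≤ (Lc : ℝ) ^ (2 * (d + 1)))]
  rw [mul_assoc (|cVH| * (Lc : ℝ) ^ (2 * (d + 1)))]
  exact mul_le_mul_of_nonneg_left h (by positivity)

/-- **ROW R3-dVt AS A FUNCTION OF THE K-SLOT's UNIFORM DECAY AND CAUCHY RATE** (the hypothesis `dVt` of `StencilSlotE3RateOfPieces.e3SupRate_of_pieces`,
statement copied from staged 33c3b428985b41f4 ∕ typer stub `S3.DiffVt`, VERBATIM; NOT IN PRINT; [folklore] over the K-slot):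
`UnitDecayK … C δ`, `CauchyDecayK … cK θ δ`, `0 < δ`, `1 ≤ Lc` ⟹ the depth-0 one-step DIFFERENCE of the unit-rescaled top border pieces of members
`n+3` ∕ `n+2` has sup norm `≤ cVt·θ^{n+1}` with `cVt = |cVH|·Lc^{2(d+1)}·e3LipConst d C C (3ℓ²e^{4(d+1)Lcδ}) δ·cK` — the rate `θ` IS the K-slot's, not
strengthened.  NO (N1-Cauchy).  Discharges NOTHING of «E3SupRate» by itself (one hypothesis of ten); NOT BetaPertH, NOT continuum, NOT Clay. -/
theorem diffVt_of_unitDecayK_cauchyDecayK (hLc : 1 ≤ Lc) {C δ cK θ : ℝ} (hδ : 0 < δ)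
    (hK : UnitDecayK d Lc (sfStep Lc) (smStep d Lc) C δ) (hKK : CauchyDecayK d Lc (sfStep Lc) (smStep d Lc) cK θ δ) (cVH : ℝ) :
    ∀ (n : ℕ) (κ' : Fin (d + 1)) (u' : Fin (d + 1) → ℤ), SupBound (fun x z a b =>
      ((Lc : ℝ) ^ (n + 1 + 1 + 1)) ^ (2 * (d + 1)) * e3OfS (Lc ^ (n + 1 + 1 + 1))
          (fun κ u => (cVH * ((Lc : ℝ) ^ (n + 1 + 1)) ^ (d + 2)) • borderInc d Lc (Lc ^ (n + 1 + 1)) κ u) κ' u' x z a b -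
        ((Lc : ℝ) ^ (n + 1 + 1)) ^ (2 * (d + 1)) * e3OfS (Lc ^ (n + 1 + 1))
          (fun κ u => (cVH * ((Lc : ℝ) ^ (n + 1)) ^ (d + 2)) • borderInc d Lc (Lc ^ (n + 1)) κ u) κ' u' x z a b)
      (|cVH| * (Lc : ℝ) ^ (2 * (d + 1)) *
          (e3LipConst d C C (3 * (ell (d + 1) Lc : ℝ) ^ 2 * Real.exp (4 * ((d : ℝ) + 1) * Lc * δ)) δ * cK) * θ ^ (n + 1)) := by
  intro n κ' u' x z a b
  dsimp only
  have h := supBound_e3K_step hK hKK (locStencil_mfNeg (locStencil_vhS (d := d) hLc hδ.le)) hδ le_rfl hLc (n + 1) κ' u' x z a b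
  rw [Pi.sub_apply] at h
  rw [unit_e3OfS_borderInc_top hLc cVH (n + 1 + 1) κ' u' x z a b, unit_e3OfS_borderInc_top hLc cVH (n + 1) κ' u' x z a b, ← mul_sub,
    abs_mul, abs_mul, abs_of_nonneg (by positivity : (0 : ℝ) ≤ (Lc : ℝ) ^ (2 * (d + 1)))]
  calc |cVH| * (Lc : ℝ) ^ (2 * (d + 1)) *
        |e3K (KStepUnit (d := d) Lc (n + 1 + 1)) Lc (fun κ u => mfNeg (vhS d Lc κ u)) κ' u' x z a b -
          e3K (KStepUnit (d := d) Lc (n + 1)) Lc (fun κ u => mfNeg (vhS d Lc κ u)) κ' u' x z a b|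
      ≤ |cVH| * (Lc : ℝ) ^ (2 * (d + 1)) *
          (e3LipConst d C C (3 * (ell (d + 1) Lc : ℝ) ^ 2 * Real.exp (4 * ((d : ℝ) + 1) * Lc * δ)) δ * cK * θ ^ (n + 1)) :=
        mul_le_mul_of_nonneg_left h (by positivity)
    _ = _ := by ring

/-- **ROW S3-Vt FROM THE ROAD-P1 FORM OF THE K-SLOT** (`ConvCK d Lc`, existential packaging): `∃ CtV δ, 0 < δ ∧ ∀ n, LocStencil (…) CtV δ`. -/
theorem shapeVt_of_convCK (hLc : 1 ≤ Lc) (h : ConvCK d Lc) (cVH : ℝ) :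
    ∃ CtV δ : ℝ, 0 < δ ∧ ∀ n : ℕ, LocStencil (fun κ' u' x' z' a b => ((Lc : ℝ) ^ (n + 1 + 1)) ^ (2 * (d + 1)) *
      e3OfS (Lc ^ (n + 1 + 1)) (fun κ u => (cVH * ((Lc : ℝ) ^ (n + 1)) ^ (d + 2)) • borderInc d Lc (Lc ^ (n + 1)) κ u) κ' u' x' z' a b)
      CtV δ := by
  obtain ⟨C, δ, c, θ, hδ, _, _, hK, _⟩ := h
  exact ⟨_, δ / 8, by positivity, shapeVt_of_unitDecayK hLc hδ hK cVH⟩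

/-- **ROW R3-dVt FROM THE WALL FORM OF THE K-SLOT** (`ConvCKWall d Lc`, existential packaging; `θ` = the K-slot's rate, `0 ≤ θ < 1`):
`∃ cVt θ, 0 ≤ θ ∧ θ < 1 ∧ ∀ n κ′ u′, SupBound (…) (cVt·θ^{n+1})`. -/
theorem diffVt_of_convCKWall (hLc : 1 ≤ Lc) (h : ConvCKWall d Lc) (cVH : ℝ) :
    ∃ cVt θ : ℝ, 0 ≤ θ ∧ θ < 1 ∧ ∀ (n : ℕ) (κ' : Fin (d + 1)) (u' : Fin (d + 1) → ℤ), SupBound (fun x z a b =>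
      ((Lc : ℝ) ^ (n + 1 + 1 + 1)) ^ (2 * (d + 1)) * e3OfS (Lc ^ (n + 1 + 1 + 1))
          (fun κ u => (cVH * ((Lc : ℝ) ^ (n + 1 + 1)) ^ (d + 2)) • borderInc d Lc (Lc ^ (n + 1 + 1)) κ u) κ' u' x z a b -
        ((Lc : ℝ) ^ (n + 1 + 1)) ^ (2 * (d + 1)) * e3OfS (Lc ^ (n + 1 + 1))
          (fun κ u => (cVH * ((Lc : ℝ) ^ (n + 1)) ^ (d + 2)) • borderInc d Lc (Lc ^ (n + 1)) κ u) κ' u' x z a b)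
      (cVt * θ ^ (n + 1)) := by
  obtain ⟨C, δ, cK, θ, hδ, hθ0, hθ1, hK, hKK⟩ := h
  exact ⟨_, θ, hθ0, hθ1, diffVt_of_unitDecayK_cauchyDecayK hLc hδ hK hKK cVH⟩

/-- **ROW R3-dVt FROM THE ROAD-P1 FORM OF THE K-SLOT** (`ConvCK d Lc`; `CombesThomas.convCKWall_of_convCK` — rate `√θ`, decay `δ/2`). -/
theorem diffVt_of_convCK (hLc : 1 ≤ Lc) (h : ConvCK d Lc) (cVH : ℝ) :
    ∃ cVt θ : ℝ, 0 ≤ θ ∧ θ < 1 ∧ ∀ (n : ℕ) (κ' : Fin (d + 1)) (u' : Fin (d + 1) → ℤ), SupBound (fun x z a b =>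
      ((Lc : ℝ) ^ (n + 1 + 1 + 1)) ^ (2 * (d + 1)) * e3OfS (Lc ^ (n + 1 + 1 + 1))
          (fun κ u => (cVH * ((Lc : ℝ) ^ (n + 1 + 1)) ^ (d + 2)) • borderInc d Lc (Lc ^ (n + 1 + 1)) κ u) κ' u' x z a b -
        ((Lc : ℝ) ^ (n + 1 + 1)) ^ (2 * (d + 1)) * e3OfS (Lc ^ (n + 1 + 1))
          (fun κ u => (cVH * ((Lc : ℝ) ^ (n + 1)) ^ (d + 2)) • borderInc d Lc (Lc ^ (n + 1)) κ u) κ' u' x z a b)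
      (cVt * θ ^ (n + 1)) :=
  diffVt_of_convCKWall hLc (convCKWall_of_convCK h) cVH

/-! ## §3 `d = 3`, `Lc ≥ 2`: the two rows from road P1's CLOSED K-slot (`KSlotAssembly.convCK_holds` / `convCKWall_holds`) -/

/-- **ROW S3-Vt AT `d = 3`, `Lc ≥ 2` — UNCONDITIONAL** (the END's hypothesis `hVt` at `d = 3`, every `d` of the row specialised: `(3 + 1)`, `(3 + 2)`,
`2 * (3 + 1)`, `borderInc 3`, per the owner's instantiation note): from road P1's `KSlotAssembly.convCK_holds`.  NOT IN PRINT; our proof.  One row of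
the SHAPE table; «E3Shape» NOT discharged by it alone; NOT BetaPertH, NOT continuum, NOT Clay. -/
theorem shapeVt_three {Lc : ℕ} [NeZero Lc] (hLc : 2 ≤ Lc) (cVH : ℝ) :
    ∃ CtV δ : ℝ, 0 < δ ∧ ∀ n : ℕ, LocStencil (fun κ' u' x' z' a b => ((Lc : ℝ) ^ (n + 1 + 1)) ^ (2 * (3 + 1)) *
      e3OfS (Lc ^ (n + 1 + 1)) (fun κ u => (cVH * ((Lc : ℝ) ^ (n + 1)) ^ (3 + 2)) • borderInc 3 Lc (Lc ^ (n + 1)) κ u) κ' u' x' z' a b)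
      CtV δ :=
  shapeVt_of_convCK (le_trans (by norm_num) hLc) (convCK_holds hLc) cVH

/-- **ROW R3-dVt AT `d = 3`, `Lc ≥ 2` — UNCONDITIONAL** (the END's hypothesis `dVt` at `d = 3`): from road P1's `KSlotAssembly.convCKWall_holds`; the rate
`θ` is the K-slot's (`0 ≤ θ < 1`), NOT strengthened.  NOT IN PRINT; our proof.  One row of the RATE table; «E3SupRate» NOT discharged by it alone;
NOT BetaPertH, NOT continuum, NOT Clay. -/
theorem diffVt_three {Lc : ℕ} [NeZero Lc] (hLc : 2 ≤ Lc) (cVH : ℝ) :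
    ∃ cVt θ : ℝ, 0 ≤ θ ∧ θ < 1 ∧ ∀ (n : ℕ) (κ' : Fin (3 + 1)) (u' : Fin (3 + 1) → ℤ), SupBound (fun x z a b =>
      ((Lc : ℝ) ^ (n + 1 + 1 + 1)) ^ (2 * (3 + 1)) * e3OfS (Lc ^ (n + 1 + 1 + 1))
          (fun κ u => (cVH * ((Lc : ℝ) ^ (n + 1 + 1)) ^ (3 + 2)) • borderInc 3 Lc (Lc ^ (n + 1 + 1)) κ u) κ' u' x z a b -
        ((Lc : ℝ) ^ (n + 1 + 1)) ^ (2 * (3 + 1)) * e3OfS (Lc ^ (n + 1 + 1))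
          (fun κ u => (cVH * ((Lc : ℝ) ^ (n + 1)) ^ (3 + 2)) • borderInc 3 Lc (Lc ^ (n + 1)) κ u) κ' u' x z a b)
      (cVt * θ ^ (n + 1)) :=
  diffVt_of_convCKWall (le_trans (by norm_num) hLc) (convCKWall_holds hLc) cVH

/-! ## §4 (v1.3) PLUG-READY FORMS: the two rows at every COMMON rate the S-TABLES-PLUG may choose (`θ ≥ θ_K`, `0 < δ ≤ δ_K/8`; ref2 r35 (l):
the plug harmonises `δ := min`, `θ := max` — these corollaries make that weakening explicit for rows Vt ∕ dVt, constants displayed nonnegative) -/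

omit [NeZero Lc] in
/-- [folklore] The dVt constant is nonnegative. -/
theorem diffVt_const_nonneg {C δ cK : ℝ} (hC : 0 ≤ C) (hδ : 0 < δ) (hcK : 0 ≤ cK) (cVH : ℝ) :
    0 ≤ |cVH| * (Lc : ℝ) ^ (2 * (d + 1)) *
      (e3LipConst d C C (3 * (ell (d + 1) Lc : ℝ) ^ 2 * Real.exp (4 * ((d : ℝ) + 1) * Lc * δ)) δ * cK) := by
  have h := ThirdJetKernel.e3LipConst_nonneg (d := d) hC hC
    (show (0 : ℝ) ≤ 3 * (ell (d + 1) Lc : ℝ) ^ 2 * Real.exp (4 * ((d : ℝ) + 1) * Lc * δ) by positivity) hδ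
  positivity

/-- **ROW R3-dVt AT EVERY COMMON RATE `θ ≥ θ_K`** (generic `d`; the plug's `θ := max` weakening made explicit, constant nonnegative):
`UnitDecayK … C δ`, `CauchyDecayK … cK θK δ`, `0 ≤ θK ≤ θ` ⟹ the dVt `SupBound` with `cVt·θ^{n+1}`, the SAME displayed `cVt ≥ 0`. -/
theorem diffVt_of_unitDecayK_cauchyDecayK_mono (hLc : 1 ≤ Lc) {C δ cK θK θ : ℝ} (hδ : 0 < δ)
    (hK : UnitDecayK d Lc (sfStep Lc) (smStep d Lc) C δ) (hKK : CauchyDecayK d Lc (sfStep Lc) (smStep d Lc) cK θK δ)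
    (hθK : 0 ≤ θK) (hθ : θK ≤ θ) (cVH : ℝ) :
    ∀ (n : ℕ) (κ' : Fin (d + 1)) (u' : Fin (d + 1) → ℤ), SupBound (fun x z a b =>
      ((Lc : ℝ) ^ (n + 1 + 1 + 1)) ^ (2 * (d + 1)) * e3OfS (Lc ^ (n + 1 + 1 + 1))
          (fun κ u => (cVH * ((Lc : ℝ) ^ (n + 1 + 1)) ^ (d + 2)) • borderInc d Lc (Lc ^ (n + 1 + 1)) κ u) κ' u' x z a b -
        ((Lc : ℝ) ^ (n + 1 + 1)) ^ (2 * (d + 1)) * e3OfS (Lc ^ (n + 1 + 1))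
          (fun κ u => (cVH * ((Lc : ℝ) ^ (n + 1)) ^ (d + 2)) • borderInc d Lc (Lc ^ (n + 1)) κ u) κ' u' x z a b)
      (|cVH| * (Lc : ℝ) ^ (2 * (d + 1)) *
          (e3LipConst d C C (3 * (ell (d + 1) Lc : ℝ) ^ 2 * Real.exp (4 * ((d : ℝ) + 1) * Lc * δ)) δ * cK) * θ ^ (n + 1)) := by
  intro n κ' u' x z a b
  have h := diffVt_of_unitDecayK_cauchyDecayK hLc hδ hK hKK cVH n κ' u' x z a b
  have hC : 0 ≤ C := (hK 0).nonneg (Sum.inl 0)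
  have hcK : 0 ≤ cK := by
    have h0 := (hKK 0 0).nonneg (Sum.inl 0)
    simpa using h0
  have hc := diffVt_const_nonneg (d := d) (Lc := Lc) hC hδ hcK cVH
  exact h.trans (mul_le_mul_of_nonneg_left (pow_le_pow_left₀ hθK hθ (n + 1)) hc)

/-- **ROW S3-Vt AT EVERY COMMON RATE `0 < δ' ≤ δ_K/8`** (generic `d`; the plug's `δ := min` weakening, `locStencil_mono`). -/
theorem shapeVt_of_unitDecayK_mono (hLc : 1 ≤ Lc) {C δ δ' : ℝ} (hδ : 0 < δ) (hK : UnitDecayK d Lc (sfStep Lc) (smStep d Lc) C δ)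
    (hδ' : δ' ≤ δ / 8) (cVH : ℝ) :
    ∀ n : ℕ, LocStencil (fun κ' u' x' z' a b => ((Lc : ℝ) ^ (n + 1 + 1)) ^ (2 * (d + 1)) *
      e3OfS (Lc ^ (n + 1 + 1)) (fun κ u => (cVH * ((Lc : ℝ) ^ (n + 1)) ^ (d + 2)) • borderInc d Lc (Lc ^ (n + 1)) κ u) κ' u' x' z' a b)
      (|cVH| * (Lc : ℝ) ^ (2 * (d + 1)) * e3ShapeConst d C (3 * (ell (d + 1) Lc : ℝ) ^ 2 * Real.exp (4 * ((d : ℝ) + 1) * Lc * δ)) δ) δ' := by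
  intro n
  have hC : 0 ≤ C := (hK 0).nonneg (Sum.inl 0)
  have hc : 0 ≤ |cVH| * (Lc : ℝ) ^ (2 * (d + 1)) *
      e3ShapeConst d C (3 * (ell (d + 1) Lc : ℝ) ^ 2 * Real.exp (4 * ((d : ℝ) + 1) * Lc * δ)) δ := by
    have h := ThirdJetKernel.e3ShapeConst_nonneg (d := d) hC
      (show (0 : ℝ) ≤ 3 * (ell (d + 1) Lc : ℝ) ^ 2 * Real.exp (4 * ((d : ℝ) + 1) * Lc * δ) by positivity) hδ
    positivity
  exact BalabanStepJets.locStencil_mono (shapeVt_of_unitDecayK hLc hδ hK cVH n) hc hδ'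

/-- **ROW R3-dVt AT `d = 3`, `Lc ≥ 2`, PLUG-READY**: `∃ θ₀ ∈ [0,1)` such that for EVERY `θ ≥ θ₀` the row holds with an explicit `cVt ≥ 0`. -/
theorem diffVt_three_mono {Lc : ℕ} [NeZero Lc] (hLc : 2 ≤ Lc) (cVH : ℝ) :
    ∃ θ₀ : ℝ, 0 ≤ θ₀ ∧ θ₀ < 1 ∧ ∀ θ : ℝ, θ₀ ≤ θ → ∃ cVt : ℝ, 0 ≤ cVt ∧
      ∀ (n : ℕ) (κ' : Fin (3 + 1)) (u' : Fin (3 + 1) → ℤ), SupBound (fun x z a b =>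
        ((Lc : ℝ) ^ (n + 1 + 1 + 1)) ^ (2 * (3 + 1)) * e3OfS (Lc ^ (n + 1 + 1 + 1))
            (fun κ u => (cVH * ((Lc : ℝ) ^ (n + 1 + 1)) ^ (3 + 2)) • borderInc 3 Lc (Lc ^ (n + 1 + 1)) κ u) κ' u' x z a b -
          ((Lc : ℝ) ^ (n + 1 + 1)) ^ (2 * (3 + 1)) * e3OfS (Lc ^ (n + 1 + 1))
            (fun κ u => (cVH * ((Lc : ℝ) ^ (n + 1)) ^ (3 + 2)) • borderInc 3 Lc (Lc ^ (n + 1)) κ u) κ' u' x z a b)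
        (cVt * θ ^ (n + 1)) := by
  obtain ⟨C, δ, cK, θK, hδ, hθ0, hθ1, hK, hKK⟩ := convCKWall_holds hLc
  have hcK : 0 ≤ cK := by
    have h0 := (hKK 0 0).nonneg (Sum.inl 0)
    simpa using h0
  refine ⟨θK, hθ0, hθ1, fun θ hθ => ⟨_, diffVt_const_nonneg (d := 3) (Lc := Lc) ((hK 0).nonneg (Sum.inl 0)) hδ hcK cVH,
    diffVt_of_unitDecayK_cauchyDecayK_mono (le_trans (by norm_num) hLc) hδ hK hKK hθ0 hθ cVH⟩⟩

/-- **ROW S3-Vt AT `d = 3`, `Lc ≥ 2`, PLUG-READY**: `∃ δ₀ > 0` such that for EVERY `0 < δ ≤ δ₀` the row holds with an explicit `CtV ≥ 0`. -/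
theorem shapeVt_three_mono {Lc : ℕ} [NeZero Lc] (hLc : 2 ≤ Lc) (cVH : ℝ) :
    ∃ δ₀ : ℝ, 0 < δ₀ ∧ ∀ δ : ℝ, δ ≤ δ₀ → ∃ CtV : ℝ, 0 ≤ CtV ∧
      ∀ n : ℕ, LocStencil (fun κ' u' x' z' a b => ((Lc : ℝ) ^ (n + 1 + 1)) ^ (2 * (3 + 1)) *
        e3OfS (Lc ^ (n + 1 + 1)) (fun κ u => (cVH * ((Lc : ℝ) ^ (n + 1)) ^ (3 + 2)) • borderInc 3 Lc (Lc ^ (n + 1)) κ u) κ' u' x' z' a b)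
        CtV δ := by
  obtain ⟨C, δ, c, θ, hδ, _, _, hK, _⟩ := convCK_holds hLc
  refine ⟨δ / 8, by positivity, fun δ' hδ' => ⟨_, ?_, shapeVt_of_unitDecayK_mono (le_trans (by norm_num) hLc) hδ hK hδ' cVH⟩⟩
  have hC : 0 ≤ C := (hK 0).nonneg (Sum.inl 0)
  have h := ThirdJetKernel.e3ShapeConst_nonneg (d := 3) hC
    (show (0 : ℝ) ≤ 3 * (ell (3 + 1) Lc : ℝ) ^ 2 * Real.exp (4 * ((3 : ℝ) + 1) * Lc * δ) by positivity) hδ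
  positivity

end Summit.QuantumFields.BalabanUV.Beta.GAN24.TopBorderKSlot

end
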